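import Summits.CriticalPhenomena.PercolationContinuityZ3.Theorems.PercNearOneGluingNoHeavyLowerTailSahiGridPatternStepTransfer
import Summits.CriticalPhenomena.PercolationContinuityZ3.Theorems.PercNearOneGluingNoHeavyLowerTailSahiGridPatternTwoSetsTop
import Summits.CriticalPhenomena.PercolationContinuityZ3.Theorems.PercNearOneGluingNoHeavyLowerTailSahiGridPatternTopOnlyTop

/-!
# `NoHeavyLowerTail` (crux stmt-CriticalPhenomena-4575), Sahi programme: **DOUBLED TOP-SLICE DOMINANCE FOR UPPER-STEP TRIPLES WITH ONE
# EMPTY BOTTOM, EVERY DIMENSION** (`sStarD ≥ 4 · sStarD(top)`, i.e. `c₂ ≥ 2c₃` on the face `{C⁰ = ∅}` of COMB-M⁺)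

Support file (seat `prim-ineq-gen-4`, generation 13; `--supports stmt-CriticalPhenomena-4575`).  Pure proofs, no definitions, no `sorry`,
standard axioms.  Vocabulary and machinery of `…SahiGridPattern{TwoLayerTop,TwoSetsTop,TopOnlyTop,Kleitman,Harris}` (`sStarD`, `ind`, `TotDist`,
`thirdPt`, `block_eq`, `sStarD_counting`, fibre Kleitman `sum_ind_lat_le_td` / `sum_lat_le_td_first`).

THE MATHEMATICS.  Let `Au, Bu, Cu ⊆ [3]^{n+1}` be an UPPER-STEP triple of up-sets along the last axis (each set has equal level-`1` and
level-`2` slices: `X₀ = X⁰ ⊆ X₁ = X₂ = X²`) and suppose ONE bottom slice is empty, `C⁰ = ∅`.  THEOREM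
(`four_mul_sStarD_top_le_of_upperStep_emptyBottom`):
  `4 · sStarD A² B² C² ≤ sStarD Au Bu Cu`,
twice the factor of top-slice dominance / COMB-M⁺ (`2 · sStarD(top) ≤ sStarD`, cube: `c₂ ≥ c₃`); in cube language `c₂ ≥ 2c₃` along the step
axis at every profile whenever one of the three bottom sections is empty (and then `c₀ = 0`, `c₁ ≥ c₃ + a₃`).  The constant `4` is attained
(e.g. `[3]^3`: `64 = 4·16`).  Consequently every cell with `c₂/c₃ < 2` — in particular the `(C¼)`-extremal cells `4c₂ = 7c₃` of the exhaustive
`m ≤ 5` census and all `585` violators of the lower-step inequality `c₁ ≥ c₃` — has all three bottom sections nonempty, as observed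
empirically (ttrl `topform/TOP.md`, RESULT l.1123 (2)).  Memo: `run/shared/lean/prim/prim-ineq-gen-4/FINDING-EMPTY-BOTTOM-FACE-g13.md`.
PROOF (five lines).  Expanding the `18` surviving level blocks (`sStarD_upperStep_emptyBottom_eq`) and the counting form of `sStarD A² B² C²`,
  `sStarD Au Bu Cu − 4·sStarD A² B² C² = 2·( [N(A²;B²,C²) − N(A⁰;B²,C²)] − [L(A²;B²,C²) − L(A⁰;B²,C²)]`
  `                                      + [N(B²;A²,C²) − N(B⁰;A²,C²)] − [L(A²;B²,C²) − L(A²;B⁰,C²)] + [N(C²;A²,B²) − N(C²;A⁰,B⁰)] )`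
(`N(X;Y,Z) = Σ_{p δ̸ q} 1_X(p)1_Y(q)1_Z(q)`, `L(X;Y,Z) = Σ_{q δ̸ r} 1_Y(q)1_Z(r)1_X(q̄r)`): the first two brackets are fibre Kleitman with the
INCREMENTS `A² ∖ A⁰`, `B² ∖ B⁰` as the free (unrestricted) argument, the last is monotonicity `1_{A⁰}1_{B⁰} ≤ 1_{A²}1_{B²}`.  (Found in the
cube model as `c₂ − 2c₃ = Σ_{x∈a}[|B′C′|_x − Λ_x(B′,C′)] + Σ_{y∈b}[|A′C′|_y − Λ_y(A′,C′)] + P(C′; aB+Ab+ab)`, each term ≥ 0.)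
Also recorded: the COMB-M⁺ hypothesis shape of `kahnConjecture_of_forall_combMplus` on this face (`two_mul_sStarD_top_le_of_upperStep_emptyBottom`).
HONEST LABEL: a face of COMB-M⁺ / (C¼), not the conjecture; nothing here asserts COMB-M⁺ in general. [this work]
-/

namespace Summit.CriticalPhenomena.PercolationContinuityZ3.Theorems.SahiGridPattern

open Finset SahiGrid3
open scoped BigOperators

variable {n : ℕ}

/-- Values of the per-axis counts on the level blocks `(i, j, k)` with `k ∈ {1,2}` (bookkeeping). [this work] -/
theorem c_vals_emptyBottom :
    c1 (0:Fin 3) 0 1 = 0 ∧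
    c1 (0:Fin 3) 0 2 = 0 ∧
    c1 (0:Fin 3) 1 1 = 0 ∧
    c1 (0:Fin 3) 1 2 = 0 ∧
    c1 (0:Fin 3) 2 1 = 0 ∧
    c1 (0:Fin 3) 2 2 = 0 ∧
    c1 (1:Fin 3) 0 1 = 0 ∧
    c1 (1:Fin 3) 0 2 = 0 ∧
    c1 (1:Fin 3) 1 1 = 2 ∧
    c1 (1:Fin 3) 1 2 = 0 ∧
    c1 (1:Fin 3) 2 1 = 0 ∧
    c1 (1:Fin 3) 2 2 = 0 ∧
    c1 (2:Fin 3) 0 1 = 0 ∧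
    c1 (2:Fin 3) 0 2 = 0 ∧
    c1 (2:Fin 3) 1 1 = 0 ∧
    c1 (2:Fin 3) 1 2 = 0 ∧
    c1 (2:Fin 3) 2 1 = 0 ∧
    c1 (2:Fin 3) 2 2 = 2 ∧
    c2 (0:Fin 3) 0 1 = 0 ∧
    c2 (0:Fin 3) 0 2 = 0 ∧
    c2 (0:Fin 3) 1 1 = 1 ∧
    c2 (0:Fin 3) 1 2 = 0 ∧
    c2 (0:Fin 3) 2 1 = 0 ∧
    c2 (0:Fin 3) 2 2 = 1 ∧
    c2 (1:Fin 3) 0 0 = 1 ∧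
    c2 (1:Fin 3) 0 1 = 0 ∧
    c2 (1:Fin 3) 0 2 = 0 ∧
    c2 (1:Fin 3) 1 0 = 0 ∧
    c2 (1:Fin 3) 1 1 = 0 ∧
    c2 (1:Fin 3) 1 2 = 0 ∧
    c2 (1:Fin 3) 2 0 = 0 ∧
    c2 (1:Fin 3) 2 1 = 0 ∧
    c2 (1:Fin 3) 2 2 = 1 ∧
    c2 (2:Fin 3) 0 0 = 1 ∧
    c2 (2:Fin 3) 0 1 = 0 ∧
    c2 (2:Fin 3) 0 2 = 0 ∧
    c2 (2:Fin 3) 1 0 = 0 ∧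
    c2 (2:Fin 3) 1 1 = 1 ∧
    c2 (2:Fin 3) 1 2 = 0 ∧
    c2 (2:Fin 3) 2 0 = 0 ∧
    c2 (2:Fin 3) 2 1 = 0 ∧
    c2 (2:Fin 3) 2 2 = 0 ∧
    c3 (0:Fin 3) 0 1 = 0 ∧
    c3 (0:Fin 3) 0 2 = 0 ∧
    c3 (0:Fin 3) 1 1 = 0 ∧
    c3 (0:Fin 3) 1 2 = 1 ∧
    c3 (0:Fin 3) 2 1 = 1 ∧
    c3 (0:Fin 3) 2 2 = 0 ∧
    c3 (1:Fin 3) 0 1 = 0 ∧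
    c3 (1:Fin 3) 0 2 = 1 ∧
    c3 (1:Fin 3) 1 1 = 0 ∧
    c3 (1:Fin 3) 1 2 = 0 ∧
    c3 (1:Fin 3) 2 1 = 0 ∧
    c3 (1:Fin 3) 2 2 = 0 ∧
    c3 (2:Fin 3) 0 1 = 1 ∧
    c3 (2:Fin 3) 0 2 = 0 ∧
    c3 (2:Fin 3) 1 1 = 0 ∧
    c3 (2:Fin 3) 1 2 = 0 ∧
    c3 (2:Fin 3) 2 1 = 0 ∧
    c3 (2:Fin 3) 2 2 = 0 := by
  unfold c1 c2 c3; decide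

/-- **The 18-block expansion**: the value of `sStarD Au Bu Cu` for an upper-step triple whose third set has empty bottom slice, in terms of the
slices `A⁰ ⊆ A²`, `B⁰ ⊆ B²`, `C²` (`D`, `N` and `L` counts). No up-set hypothesis needed. [this work] -/
theorem sStarD_upperStep_emptyBottom_eq (Au Bu Cu : Finset (Pd (n + 1)))
    (hAu : ∀ q : Pd n, ind Au (Fin.snoc q 1 : Pd (n + 1)) = ind Au (Fin.snoc q 2 : Pd (n + 1)))
    (hBu : ∀ q : Pd n, ind Bu (Fin.snoc q 1 : Pd (n + 1)) = ind Bu (Fin.snoc q 2 : Pd (n + 1)))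
    (hCu : ∀ q : Pd n, ind Cu (Fin.snoc q 1 : Pd (n + 1)) = ind Cu (Fin.snoc q 2 : Pd (n + 1)))
    (hC0 : ∀ q : Pd n, (Fin.snoc q 0 : Pd (n + 1)) ∉ Cu) :
    sStarD Au Bu Cu =
      8 * 2 ^ n * (∑ p, ind (univ.filter fun q : Pd n => (Fin.snoc q 2 : Pd (n + 1)) ∈ Au) p * ind (univ.filter fun q : Pd n => (Fin.snoc q 2 : Pd (n + 1)) ∈ Bu) p * ind (univ.filter fun q : Pd n => (Fin.snoc q 2 : Pd (n + 1)) ∈ Cu) p)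
      - 2 * (∑ p, ∑ q, ind (univ.filter fun q : Pd n => (Fin.snoc q 2 : Pd (n + 1)) ∈ Cu) p * ind (univ.filter fun q : Pd n => (Fin.snoc q 0 : Pd (n + 1)) ∈ Au) q * ind (univ.filter fun q : Pd n => (Fin.snoc q 0 : Pd (n + 1)) ∈ Bu) q * (if TotDist p q = true then (1:ℤ) else 0))
      - 2 * (∑ p, ∑ q, ind (univ.filter fun q : Pd n => (Fin.snoc q 0 : Pd (n + 1)) ∈ Au) p * ind (univ.filter fun q : Pd n => (Fin.snoc q 2 : Pd (n + 1)) ∈ Bu) q * ind (univ.filter fun q : Pd n => (Fin.snoc q 2 : Pd (n + 1)) ∈ Cu) q * (if TotDist p q = true then (1:ℤ) else 0))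
      + 2 * (∑ q, ∑ r, ind (univ.filter fun q : Pd n => (Fin.snoc q 2 : Pd (n + 1)) ∈ Bu) q * ind (univ.filter fun q : Pd n => (Fin.snoc q 2 : Pd (n + 1)) ∈ Cu) r * ind (univ.filter fun q : Pd n => (Fin.snoc q 0 : Pd (n + 1)) ∈ Au) (thirdPt q r) * (if TotDist q r = true then (1:ℤ) else 0))
      - 2 * (∑ p, ∑ q, ind (univ.filter fun q : Pd n => (Fin.snoc q 0 : Pd (n + 1)) ∈ Bu) p * ind (univ.filter fun q : Pd n => (Fin.snoc q 2 : Pd (n + 1)) ∈ Au) q * ind (univ.filter fun q : Pd n => (Fin.snoc q 2 : Pd (n + 1)) ∈ Cu) q * (if TotDist p q = true then (1:ℤ) else 0))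
      + 2 * (∑ q, ∑ r, ind (univ.filter fun q : Pd n => (Fin.snoc q 0 : Pd (n + 1)) ∈ Bu) q * ind (univ.filter fun q : Pd n => (Fin.snoc q 2 : Pd (n + 1)) ∈ Cu) r * ind (univ.filter fun q : Pd n => (Fin.snoc q 2 : Pd (n + 1)) ∈ Au) (thirdPt q r) * (if TotDist q r = true then (1:ℤ) else 0))
      - 2 * (∑ p, ∑ q, ind (univ.filter fun q : Pd n => (Fin.snoc q 2 : Pd (n + 1)) ∈ Cu) p * ind (univ.filter fun q : Pd n => (Fin.snoc q 2 : Pd (n + 1)) ∈ Au) q * ind (univ.filter fun q : Pd n => (Fin.snoc q 2 : Pd (n + 1)) ∈ Bu) q * (if TotDist p q = true then (1:ℤ) else 0))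
      - 2 * (∑ p, ∑ q, ind (univ.filter fun q : Pd n => (Fin.snoc q 2 : Pd (n + 1)) ∈ Bu) p * ind (univ.filter fun q : Pd n => (Fin.snoc q 2 : Pd (n + 1)) ∈ Au) q * ind (univ.filter fun q : Pd n => (Fin.snoc q 2 : Pd (n + 1)) ∈ Cu) q * (if TotDist p q = true then (1:ℤ) else 0))
      - 2 * (∑ p, ∑ q, ind (univ.filter fun q : Pd n => (Fin.snoc q 2 : Pd (n + 1)) ∈ Au) p * ind (univ.filter fun q : Pd n => (Fin.snoc q 2 : Pd (n + 1)) ∈ Bu) q * ind (univ.filter fun q : Pd n => (Fin.snoc q 2 : Pd (n + 1)) ∈ Cu) q * (if TotDist p q = true then (1:ℤ) else 0)) := by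
  set A0 : Finset (Pd n) := univ.filter fun q : Pd n => (Fin.snoc q 0 : Pd (n + 1)) ∈ Au with hA0def
  set A2 : Finset (Pd n) := univ.filter fun q : Pd n => (Fin.snoc q 2 : Pd (n + 1)) ∈ Au with hA2def
  set B0 : Finset (Pd n) := univ.filter fun q : Pd n => (Fin.snoc q 0 : Pd (n + 1)) ∈ Bu with hB0def
  set B2 : Finset (Pd n) := univ.filter fun q : Pd n => (Fin.snoc q 2 : Pd (n + 1)) ∈ Bu with hB2def
  set C2 : Finset (Pd n) := univ.filter fun q : Pd n => (Fin.snoc q 2 : Pd (n + 1)) ∈ Cu with hC2def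
  have iA0 : ∀ p, ind Au (Fin.snoc p 0) = ind A0 p := fun p => by rw [hA0def, ind_filter_snoc]
  have iA2 : ∀ p, ind Au (Fin.snoc p 2) = ind A2 p := fun p => by rw [hA2def, ind_filter_snoc]
  have iA1 : ∀ p, ind Au (Fin.snoc p 1) = ind A2 p := fun p => by rw [hAu p, iA2]
  have iB0 : ∀ p, ind Bu (Fin.snoc p 0) = ind B0 p := fun p => by rw [hB0def, ind_filter_snoc]
  have iB2 : ∀ p, ind Bu (Fin.snoc p 2) = ind B2 p := fun p => by rw [hB2def, ind_filter_snoc]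
  have iB1 : ∀ p, ind Bu (Fin.snoc p 1) = ind B2 p := fun p => by rw [hBu p, iB2]
  have iC2 : ∀ p, ind Cu (Fin.snoc p 2) = ind C2 p := fun p => by rw [hC2def, ind_filter_snoc]
  have iC1 : ∀ p, ind Cu (Fin.snoc p 1) = ind C2 p := fun p => by rw [hCu p, iC2]
  have iC0 : ∀ p, ind Cu (Fin.snoc p 0) = 0 := fun p => by unfold ind; rw [if_neg (hC0 p)]
  rw [sStarD_eq_sum_ind]
  simp only [sum_snoc, Fin.sum_univ_three, iA0, iA1, iA2, iB0, iB1, iB2, iC0, iC1, iC2, zero_mul, mul_zero,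
    Finset.sum_const_zero, zero_add, Finset.sum_add_distrib]
  rw [block_eq, block_eq, block_eq, block_eq, block_eq, block_eq, block_eq, block_eq, block_eq, block_eq, block_eq, block_eq, block_eq, block_eq, block_eq, block_eq, block_eq, block_eq]
  obtain ⟨v0, v1, v2, v3, v4, v5, v6, v7, v8, v9, v10, v11, v12, v13, v14, v15, v16, v17, v18, v19, v20, v21, v22, v23, v24, v25, v26, v27, v28, v29, v30, v31, v32, v33, v34, v35, v36, v37, v38, v39, v40, v41, v42, v43, v44, v45, v46, v47, v48, v49, v50, v51, v52, v53, v54, v55, v56, v57, v58, v59⟩ := c_vals_emptyBottom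
  rw [v0, v1, v2, v3, v4, v5, v6, v7, v8, v9, v10, v11, v12, v13, v14, v15, v16, v17, v18, v19, v20, v21, v22, v23, v24, v25, v26, v27, v28, v29, v30, v31, v32, v33, v34, v35, v36, v37, v38, v39, v40, v41, v42, v43, v44, v45, v46, v47, v48, v49, v50, v51, v52, v53, v54, v55, v56, v57, v58, v59]
  ring

/-- Monotonicity of an `N`-count in its two diagonal arguments (bookkeeping): `N(X;u,v) ≤ N(X;U,V)` for `u ⊆ U`, `v ⊆ V` indicatorwise. [this work] -/
theorem sum_ind3_totDist_mono (X : Finset (Pd n)) {u U v V : Finset (Pd n)} (hu : ∀ p, ind u p ≤ ind U p) (hv : ∀ p, ind v p ≤ ind V p) :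
    (∑ p, ∑ q, ind X p * ind u q * ind v q * (if TotDist p q = true then (1:ℤ) else 0)) ≤
      ∑ p, ∑ q, ind X p * ind U q * ind V q * (if TotDist p q = true then (1:ℤ) else 0) := by
  refine Finset.sum_le_sum fun p _ => Finset.sum_le_sum fun q _ => ?_
  have h1 : ind u q * ind v q ≤ ind U q * ind V q := mul_le_mul (hu q) (hv q) (ind_nonneg' v q) (ind_nonneg' U q)
  have h2 : 0 ≤ ind X p * (if TotDist p q = true then (1:ℤ) else 0) := mul_nonneg (ind_nonneg' X p) (by split_ifs <;> norm_num)
  nlinarith [h1, h2]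

/-- **DOUBLED TOP-SLICE DOMINANCE ON THE EMPTY-BOTTOM FACE** (every `n`): for an upper-step triple of up-sets `Au, Bu, Cu ⊆ [3]^{n+1}`
(level-`1` slice = level-`2` slice for each set) whose third set has EMPTY bottom slice, `4 · sStarD A² B² C² ≤ sStarD Au Bu Cu`
(cube: `c₂ ≥ 2c₃`).  Proof: the 18-block expansion, the counting form of the top functional, fibre Kleitman with the increments `A² ∖ A⁰` and
`B² ∖ B⁰` as free argument, and `N(C²;A⁰,B⁰) ≤ N(C²;A²,B²)`. [this work] -/
theorem four_mul_sStarD_top_le_of_upperStep_emptyBottom (Au Bu Cu : Finset (Pd (n + 1)))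
    (hA : IsUpperSet (Au : Set (Pd (n + 1)))) (hB : IsUpperSet (Bu : Set (Pd (n + 1)))) (hC : IsUpperSet (Cu : Set (Pd (n + 1))))
    (hAu : ∀ q : Pd n, ind Au (Fin.snoc q 1 : Pd (n + 1)) = ind Au (Fin.snoc q 2 : Pd (n + 1)))
    (hBu : ∀ q : Pd n, ind Bu (Fin.snoc q 1 : Pd (n + 1)) = ind Bu (Fin.snoc q 2 : Pd (n + 1)))
    (hCu : ∀ q : Pd n, ind Cu (Fin.snoc q 1 : Pd (n + 1)) = ind Cu (Fin.snoc q 2 : Pd (n + 1)))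
    (hC0 : ∀ q : Pd n, (Fin.snoc q 0 : Pd (n + 1)) ∉ Cu) :
    4 * sStarD (univ.filter fun q : Pd n => (Fin.snoc q 2 : Pd (n + 1)) ∈ Au)
          (univ.filter fun q : Pd n => (Fin.snoc q 2 : Pd (n + 1)) ∈ Bu)
          (univ.filter fun q : Pd n => (Fin.snoc q 2 : Pd (n + 1)) ∈ Cu) ≤ sStarD Au Bu Cu := by
  set A0 : Finset (Pd n) := univ.filter fun q : Pd n => (Fin.snoc q 0 : Pd (n + 1)) ∈ Au with hA0def
  set A2 : Finset (Pd n) := univ.filter fun q : Pd n => (Fin.snoc q 2 : Pd (n + 1)) ∈ Au with hA2def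
  set B0 : Finset (Pd n) := univ.filter fun q : Pd n => (Fin.snoc q 0 : Pd (n + 1)) ∈ Bu with hB0def
  set B2 : Finset (Pd n) := univ.filter fun q : Pd n => (Fin.snoc q 2 : Pd (n + 1)) ∈ Bu with hB2def
  set C2 : Finset (Pd n) := univ.filter fun q : Pd n => (Fin.snoc q 2 : Pd (n + 1)) ∈ Cu with hC2def
  have eA := sStarD_upperStep_emptyBottom_eq Au Bu Cu hAu hBu hCu hC0
  have eT := sStarD_counting A2 B2 C2
  -- up-set and nesting facts for the slices
  have hA2up : IsUpperSet (A2 : Set (Pd n)) := by rw [hA2def]; exact isUpperSet_filter_snoc hA 2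
  have hB2up : IsUpperSet (B2 : Set (Pd n)) := by rw [hB2def]; exact isUpperSet_filter_snoc hB 2
  have hC2up : IsUpperSet (C2 : Set (Pd n)) := by rw [hC2def]; exact isUpperSet_filter_snoc hC 2
  have sA : A0 ⊆ A2 := by
    intro q hq
    rw [hA0def, mem_filter] at hq
    rw [hA2def, mem_filter]
    exact ⟨mem_univ _, hA (snoc_le_snoc_of_le q (by decide : (0:Fin 3) ≤ 2)) hq.2⟩
  have sB : B0 ⊆ B2 := by
    intro q hq
    rw [hB0def, mem_filter] at hq
    rw [hB2def, mem_filter]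
    exact ⟨mem_univ _, hB (snoc_le_snoc_of_le q (by decide : (0:Fin 3) ≤ 2)) hq.2⟩
  have nA : ∀ p, ind A0 p ≤ ind A2 p := fun p => by
    have iA0 : ind Au (Fin.snoc p 0) = ind A0 p := by rw [hA0def, ind_filter_snoc]
    have iA2 : ind Au (Fin.snoc p 2) = ind A2 p := by rw [hA2def, ind_filter_snoc]
    rw [← iA0, ← iA2]; exact ind_snoc_mono hA p (by decide)
  have nB : ∀ p, ind B0 p ≤ ind B2 p := fun p => by
    have iB0 : ind Bu (Fin.snoc p 0) = ind B0 p := by rw [hB0def, ind_filter_snoc]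
    have iB2 : ind Bu (Fin.snoc p 2) = ind B2 p := by rw [hB2def, ind_filter_snoc]
    rw [← iB0, ← iB2]; exact ind_snoc_mono hB p (by decide)
  -- fibre Kleitman with the increment `A² ∖ A⁰` as free argument (first-point form)
  have Ka0 := sum_lat_le_td_first (A2 \ A0) hB2up hC2up
  have Ka : (∑ q, ∑ r, ind B2 q * ind C2 r * ind A2 (thirdPt q r) * (if TotDist q r = true then (1:ℤ) else 0))
      - (∑ q, ∑ r, ind B2 q * ind C2 r * ind A0 (thirdPt q r) * (if TotDist q r = true then (1:ℤ) else 0)) ≤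
      (∑ p, ∑ q, ind A2 p * ind B2 q * ind C2 q * (if TotDist p q = true then (1:ℤ) else 0))
      - (∑ p, ∑ q, ind A0 p * ind B2 q * ind C2 q * (if TotDist p q = true then (1:ℤ) else 0)) := by
    have e1 : (∑ q, ∑ r, ind B2 q * ind C2 r * ind (A2 \ A0) (thirdPt q r) * (if TotDist q r = true then (1:ℤ) else 0)) =
        (∑ q, ∑ r, ind B2 q * ind C2 r * ind A2 (thirdPt q r) * (if TotDist q r = true then (1:ℤ) else 0))
        - (∑ q, ∑ r, ind B2 q * ind C2 r * ind A0 (thirdPt q r) * (if TotDist q r = true then (1:ℤ) else 0)) := by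
      rw [← Finset.sum_sub_distrib]
      refine Finset.sum_congr rfl fun q _ => ?_
      rw [← Finset.sum_sub_distrib]
      refine Finset.sum_congr rfl fun r _ => ?_
      rw [ind_sdiff_of_subset sA]; ring
    have e2 : (∑ p, ∑ q, ind (A2 \ A0) p * ind B2 q * ind C2 q * (if TotDist p q = true then (1:ℤ) else 0)) =
        (∑ p, ∑ q, ind A2 p * ind B2 q * ind C2 q * (if TotDist p q = true then (1:ℤ) else 0))
        - (∑ p, ∑ q, ind A0 p * ind B2 q * ind C2 q * (if TotDist p q = true then (1:ℤ) else 0)) := by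
      rw [← Finset.sum_sub_distrib]
      refine Finset.sum_congr rfl fun p _ => ?_
      rw [← Finset.sum_sub_distrib]
      refine Finset.sum_congr rfl fun q _ => ?_
      rw [ind_sdiff_of_subset sA]; ring
    rw [← e1, ← e2]; exact Ka0
  -- fibre Kleitman with the increment `B² ∖ B⁰` as free argument
  have Kb0 := sum_ind_lat_le_td (B2 \ B0) hC2up hA2up
  have Kb : (∑ q, ∑ r, ind B2 q * ind C2 r * ind A2 (thirdPt q r) * (if TotDist q r = true then (1:ℤ) else 0))
      - (∑ q, ∑ r, ind B0 q * ind C2 r * ind A2 (thirdPt q r) * (if TotDist q r = true then (1:ℤ) else 0)) ≤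
      (∑ p, ∑ q, ind B2 p * ind A2 q * ind C2 q * (if TotDist p q = true then (1:ℤ) else 0))
      - (∑ p, ∑ q, ind B0 p * ind A2 q * ind C2 q * (if TotDist p q = true then (1:ℤ) else 0)) := by
    have e1 : (∑ p, ∑ q, ind (B2 \ B0) p * ind C2 q * ind A2 (thirdPt p q) * (if TotDist p q = true then (1:ℤ) else 0)) =
        (∑ q, ∑ r, ind B2 q * ind C2 r * ind A2 (thirdPt q r) * (if TotDist q r = true then (1:ℤ) else 0))
        - (∑ q, ∑ r, ind B0 q * ind C2 r * ind A2 (thirdPt q r) * (if TotDist q r = true then (1:ℤ) else 0)) := by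
      rw [← Finset.sum_sub_distrib]
      refine Finset.sum_congr rfl fun p _ => ?_
      rw [← Finset.sum_sub_distrib]
      refine Finset.sum_congr rfl fun q _ => ?_
      rw [ind_sdiff_of_subset sB]; ring
    have e2 : (∑ p, ∑ q, ind (B2 \ B0) p * ind C2 q * ind A2 q * (if TotDist p q = true then (1:ℤ) else 0)) =
        (∑ p, ∑ q, ind B2 p * ind A2 q * ind C2 q * (if TotDist p q = true then (1:ℤ) else 0))
        - (∑ p, ∑ q, ind B0 p * ind A2 q * ind C2 q * (if TotDist p q = true then (1:ℤ) else 0)) := by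
      rw [← Finset.sum_sub_distrib]
      refine Finset.sum_congr rfl fun p _ => ?_
      rw [← Finset.sum_sub_distrib]
      refine Finset.sum_congr rfl fun q _ => ?_
      rw [ind_sdiff_of_subset sB]; ring
    rw [← e1, ← e2]; exact Kb0
  -- monotonicity of the `C²`-count
  have NC := sum_ind3_totDist_mono C2 nA nB
  rw [eT, eA]
  linarith

/-- The same face in the COMB-M⁺ hypothesis shape of `kahnConjecture_of_forall_combMplus` (`2·sStarD(top) ≤ 1·sStarD`), given that the top
functional is nonnegative (e.g. from `PatternPos n` in an induction): on the empty-bottom face even `4·sStarD(top) ≤ sStarD`. [this work] -/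
theorem two_mul_sStarD_top_le_of_upperStep_emptyBottom (Au Bu Cu : Finset (Pd (n + 1)))
    (hA : IsUpperSet (Au : Set (Pd (n + 1)))) (hB : IsUpperSet (Bu : Set (Pd (n + 1)))) (hC : IsUpperSet (Cu : Set (Pd (n + 1))))
    (hAu : ∀ q : Pd n, ind Au (Fin.snoc q 1 : Pd (n + 1)) = ind Au (Fin.snoc q 2 : Pd (n + 1)))
    (hBu : ∀ q : Pd n, ind Bu (Fin.snoc q 1 : Pd (n + 1)) = ind Bu (Fin.snoc q 2 : Pd (n + 1)))
    (hCu : ∀ q : Pd n, ind Cu (Fin.snoc q 1 : Pd (n + 1)) = ind Cu (Fin.snoc q 2 : Pd (n + 1)))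
    (hC0 : ∀ q : Pd n, (Fin.snoc q 0 : Pd (n + 1)) ∉ Cu)
    (hpos : 0 ≤ sStarD (univ.filter fun q : Pd n => (Fin.snoc q 2 : Pd (n + 1)) ∈ Au)
      (univ.filter fun q : Pd n => (Fin.snoc q 2 : Pd (n + 1)) ∈ Bu)
      (univ.filter fun q : Pd n => (Fin.snoc q 2 : Pd (n + 1)) ∈ Cu)) :
    2 * sStarD (univ.filter fun q : Pd n => (Fin.snoc q 2 : Pd (n + 1)) ∈ Au)
          (univ.filter fun q : Pd n => (Fin.snoc q 2 : Pd (n + 1)) ∈ Bu)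
          (univ.filter fun q : Pd n => (Fin.snoc q 2 : Pd (n + 1)) ∈ Cu) ≤ 1 * sStarD Au Bu Cu := by
  have h4 := four_mul_sStarD_top_le_of_upperStep_emptyBottom Au Bu Cu hA hB hC hAu hBu hCu hC0
  linarith

/-! ### The lower-step companion: `c₁ ≥ c₃` on the empty-bottom face -/

/-- `sStarD` vanishes when one argument is empty. [this work] -/
theorem sStarD_empty_right (A B : Finset (Pd n)) : sStarD A B (∅ : Finset (Pd n)) = 0 := by
  rw [sStarD_eq_sum_tcD]
  simp

/-- **LOWER-STEP TOP-SLICE DOMINANCE ON THE EMPTY-BOTTOM FACE** (every `n`): for an upper-step triple `Au, Bu, Cu ⊆ [3]^{n+1}` with `C⁰ = ∅`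
and its LOWER-STEP companion `Al, Bl, Cl` (levels `0,1` carry the bottom slices, level `2` the top slices), `2 · sStarD A² B² C² ≤ sStarD Al Bl Cl`
(cube: `c₁ ≥ c₃`; in fact `c₁ ≥ c₃ + a₃`).  Proof: the step-transfer identity (`sStarD_lowerStep_sub_upperStep_nonneg`), the vanishing of the
bottom functional (`C⁰ = ∅`) and the doubled dominance `4 · sStarD(top) ≤ sStarD Au Bu Cu`.  So every violator of the lower-step inequality
`c₁ ≥ c₃` (ttrl: 585 cells at `m = 5`, none below) has all three bottom sections nonempty. [this work] -/
theorem two_mul_sStarD_top_le_lowerStep_emptyBottom (Au Bu Cu Al Bl Cl : Finset (Pd (n + 1)))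
    (hA : IsUpperSet (Au : Set (Pd (n + 1)))) (hB : IsUpperSet (Bu : Set (Pd (n + 1)))) (hC : IsUpperSet (Cu : Set (Pd (n + 1))))
    (hAu : ∀ q : Pd n, ind Au (Fin.snoc q 1 : Pd (n + 1)) = ind Au (Fin.snoc q 2 : Pd (n + 1)))
    (hBu : ∀ q : Pd n, ind Bu (Fin.snoc q 1 : Pd (n + 1)) = ind Bu (Fin.snoc q 2 : Pd (n + 1)))
    (hCu : ∀ q : Pd n, ind Cu (Fin.snoc q 1 : Pd (n + 1)) = ind Cu (Fin.snoc q 2 : Pd (n + 1)))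
    (hAl0 : ∀ q : Pd n, ind Al (Fin.snoc q 0 : Pd (n + 1)) = ind Au (Fin.snoc q 0 : Pd (n + 1)))
    (hAl1 : ∀ q : Pd n, ind Al (Fin.snoc q 1 : Pd (n + 1)) = ind Au (Fin.snoc q 0 : Pd (n + 1)))
    (hAl2 : ∀ q : Pd n, ind Al (Fin.snoc q 2 : Pd (n + 1)) = ind Au (Fin.snoc q 2 : Pd (n + 1)))
    (hBl0 : ∀ q : Pd n, ind Bl (Fin.snoc q 0 : Pd (n + 1)) = ind Bu (Fin.snoc q 0 : Pd (n + 1)))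
    (hBl1 : ∀ q : Pd n, ind Bl (Fin.snoc q 1 : Pd (n + 1)) = ind Bu (Fin.snoc q 0 : Pd (n + 1)))
    (hBl2 : ∀ q : Pd n, ind Bl (Fin.snoc q 2 : Pd (n + 1)) = ind Bu (Fin.snoc q 2 : Pd (n + 1)))
    (hCl0 : ∀ q : Pd n, ind Cl (Fin.snoc q 0 : Pd (n + 1)) = ind Cu (Fin.snoc q 0 : Pd (n + 1)))
    (hCl1 : ∀ q : Pd n, ind Cl (Fin.snoc q 1 : Pd (n + 1)) = ind Cu (Fin.snoc q 0 : Pd (n + 1)))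
    (hCl2 : ∀ q : Pd n, ind Cl (Fin.snoc q 2 : Pd (n + 1)) = ind Cu (Fin.snoc q 2 : Pd (n + 1)))
    (hC0 : ∀ q : Pd n, (Fin.snoc q 0 : Pd (n + 1)) ∉ Cu) :
    2 * sStarD (univ.filter fun q : Pd n => (Fin.snoc q 2 : Pd (n + 1)) ∈ Au)
               (univ.filter fun q : Pd n => (Fin.snoc q 2 : Pd (n + 1)) ∈ Bu)
               (univ.filter fun q : Pd n => (Fin.snoc q 2 : Pd (n + 1)) ∈ Cu) ≤ sStarD Al Bl Cl := by
  have h1 := sStarD_lowerStep_sub_upperStep_nonneg Au Bu Cu Al Bl Cl hA hB hC hAu hBu hCu hAl0 hAl1 hAl2 hBl0 hBl1 hBl2 hCl0 hCl1 hCl2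
  have h4 := four_mul_sStarD_top_le_of_upperStep_emptyBottom Au Bu Cu hA hB hC hAu hBu hCu hC0
  have hC0e : (univ.filter fun q : Pd n => (Fin.snoc q 0 : Pd (n + 1)) ∈ Cu) = (∅ : Finset (Pd n)) := by
    ext q
    constructor
    · intro hq
      rw [mem_filter] at hq
      exact absurd hq.2 (hC0 q)
    · intro hq
      exact absurd hq (Finset.notMem_empty q)
  have h0 : sStarD (univ.filter fun q : Pd n => (Fin.snoc q 0 : Pd (n + 1)) ∈ Au)
      (univ.filter fun q : Pd n => (Fin.snoc q 0 : Pd (n + 1)) ∈ Bu)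
      (univ.filter fun q : Pd n => (Fin.snoc q 0 : Pd (n + 1)) ∈ Cu) = 0 := by
    rw [hC0e]; exact sStarD_empty_right _ _
  linarith


end Summit.CriticalPhenomena.PercolationContinuityZ3.Theorems.SahiGridPattern
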